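import Summits.FinalStateConjecture.FinalStateConjecture.Theorems.PhotonSphereChannelsChannelsResolveTameDevelopmentsRKerrDocTransfer
import Literature.Geometry.Lorentzian.KerrData
import HarnessLib

/-!
# Route PhotonSphereChannels · crux `ChannelsResolveTameDevelopmentsR` (K2R-T2, stmt-FinalStateConjecture-17430) ·
# line `tame-lasalle-dock` · stub R: PUSH-FORWARD of the dock data along an orientation-preserving isometric embedding
# (from a globally hyperbolic REPRESENTATIVE back to the hull element)

Stub R of the line transfers SEK (rigidity of silent eternal vacua, docked onto items stmt-10034/stmt-10745) to the
hull elements of a tame development. SEK needs GLOBAL HYPERBOLICITY of the spacetime it is applied to, and hull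
elements carry no covering clause (`Spacetime.SubconvergesLocallyTo.restrict'`): an element trimmed inside its
black-hole region is again an element and is not globally hyperbolic. The honest form of R's side condition (G2)
is therefore a globally hyperbolic REPRESENTATIVE `𝓢'` carrying an isometric copy of the element's domain of outer
communications, `j : 𝓢' → 𝓢`, `j '' O' = E.doc`. The companion file `…RKerrDocTransfer.lean` (T1) PULLS an exact
Kerr d.o.c. BACK along such a `j`; this file PUSHES the dock data FORWARD along `j`, which is what the
representative route needs:

* `isLocalIsometry_comp` — local isometries compose;
* `kerrExteriorUpToOrientation_image` — U's conclusion shape "an injective local isometry of the smooth Kerr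
  exterior onto `O'`" pushes forward to `j '' O'` (so the sub-extremality test (G5) may be run in `𝓢`);
* `isKerrDoc_image_of_isLocalIsometry` — `TameHull.IsKerrDoc 𝓢' O' M a` pushes forward to
  `IsKerrDoc 𝓢 (j '' O') M a` when `dj` preserves future-directedness;
* `isMinkowski_of_isLocalIsometry_of_surjective` — `TameHull.IsMinkowski` pushes forward along a SURJECTIVE such
  `j` (the complete-representative case, where `j` is onto).

All statements are about two abstract spacetimes and a map; no route item is restated.

References: O'Neill 1983, Ch. 3, pp. 58, 90–91; Ch. 5, p. 145 [ONeill1983]; Dafermos–Luk 2017, Conjecture 1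
[DafermosLuk2017].
-/

noncomputable section

-- the operator-norm instance on `E4 →L[ℝ] E4 →L[ℝ] ℝ` needs one more level of pending
-- instance problems than the default (as in `PhotonSphereChannelsTameHullDefs.lean`)
set_option maxSynthPendingDepth 3
-- every `Summit.FinalStateConjecture.FinalStateConjecture.…` name repeats the summit = sub-problem segment (D-0017 layout)
set_option linter.dupNamespace false

open Set Filter Function TopologicalSpace Manifold Bundle
open scoped Topology Manifold ContDiff ENNReal NNReal

namespace Summit.FinalStateConjecture.FinalStateConjecture.Theorems.TameLaSalle

open Literature.Geometry.Lorentzian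
open Summit.FinalStateConjecture.FinalStateConjecture.Theorems.TameHull
open Summit.FinalStateConjecture.FinalStateConjecture.Theorems.DarkFuture

section Comp

variable {E₁ : Type*} [NormedAddCommGroup E₁] [NormedSpace ℝ E₁] {H₁ : Type*} [TopologicalSpace H₁]
  {I₁ : ModelWithCorners ℝ E₁ H₁} {X₁ : Type*} [TopologicalSpace X₁] [ChartedSpace H₁ X₁]
  {E₂ : Type*} [NormedAddCommGroup E₂] [NormedSpace ℝ E₂] {H₂ : Type*} [TopologicalSpace H₂]
  {I₂ : ModelWithCorners ℝ E₂ H₂} {X₂ : Type*} [TopologicalSpace X₂] [ChartedSpace H₂ X₂]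
  {E₃ : Type*} [NormedAddCommGroup E₃] [NormedSpace ℝ E₃] {H₃ : Type*} [TopologicalSpace H₃]
  {I₃ : ModelWithCorners ℝ E₃ H₃} {X₃ : Type*} [TopologicalSpace X₃] [ChartedSpace H₃ X₃]
  [IsManifold I₁ ∞ X₁] [IsManifold I₂ ∞ X₂] [IsManifold I₃ ∞ X₃] {n : ℕ∞ω}
  {g₁ : PseudoRiemannianMetric I₁ n E₁ (TangentSpace I₁ : X₁ → Type _)}
  {g₂ : PseudoRiemannianMetric I₂ n E₂ (TangentSpace I₂ : X₂ → Type _)}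
  {g₃ : PseudoRiemannianMetric I₃ n E₃ (TangentSpace I₃ : X₃ → Type _)}

/-- **Local isometries compose**: `j ∘ f` is a local diffeomorphism (`IsLocalDiffeomorphAt.comp`) and
`(j ∘ f)^* g₃ = f^* (j^* g₃) = f^* g₂ = g₁` (chain rule `pullbackBilin_comp`). Requires `n ≠ 0` (differentiability).
O'Neill 1983, Ch. 3, pp. 90–91. [cite: ONeill1983, Ch. 3, pp. 90–91] -/
theorem isLocalIsometry_comp (hn : n ≠ 0) {f : X₁ → X₂} {j : X₂ → X₃}
    (hf : PseudoRiemannianMetric.IsLocalIsometry g₁ g₂ f) (hj : PseudoRiemannianMetric.IsLocalIsometry g₂ g₃ j) :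
    PseudoRiemannianMetric.IsLocalIsometry g₁ g₃ (j ∘ f) := by
  refine ⟨fun x ↦ (hf.1 x).comp _ _ (hj.1 (f x)), fun y ↦ ?_⟩
  rw [pullbackBilin_comp (hj.1.mdifferentiable hn) (hf.1.mdifferentiable hn), funext hj.2]
  exact hf.2 y

end Comp

/-- **U's conclusion shape pushes forward along an injective local isometry.** If `Ψ'` is an injective local
isometry of the smooth Kerr exterior `(Kerr.exterior M a, Kerr.smoothMetric M a r₊)` onto `O' ⊆ 𝓢'` and
`j : 𝓢' → 𝓢` is an injective local isometry, then `j ∘ Ψ'` is an injective local isometry of the Kerr exterior onto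
`j '' O'`. (Used to run the sub-extremality test (G5) of stub R in the hull element `𝓢` rather than in its
representative `𝓢'`.) O'Neill 1983, Ch. 3, pp. 90–91. [cite: ONeill1983, Ch. 3, pp. 90–91] -/
theorem kerrExteriorUpToOrientation_image {𝓢 𝓢' : Spacetime.{0} 4} [Kerr.Facts] {j : 𝓢'.carrier → 𝓢.carrier}
    (hj : Function.Injective j)
    (hiso : PseudoRiemannianMetric.IsLocalIsometry 𝓢'.metric.toPseudoRiemannianMetric
      𝓢.metric.toPseudoRiemannianMetric j)
    {O' : Set 𝓢'.carrier} {M a : ℝ}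
    (h : ∃ Ψ : Kerr.exterior M a → 𝓢'.carrier, Function.Injective Ψ ∧ Set.range Ψ = O' ∧
      PseudoRiemannianMetric.IsLocalIsometry (Kerr.smoothMetric M a (Kerr.rPlus M a)).toPseudoRiemannianMetric
        𝓢'.metric.toPseudoRiemannianMetric Ψ) :
    ∃ Ψ : Kerr.exterior M a → 𝓢.carrier, Function.Injective Ψ ∧ Set.range Ψ = j '' O' ∧
      PseudoRiemannianMetric.IsLocalIsometry (Kerr.smoothMetric M a (Kerr.rPlus M a)).toPseudoRiemannianMetric
        𝓢.metric.toPseudoRiemannianMetric Ψ := by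
  obtain ⟨Ψ, hinj, hrange, hΨ⟩ := h
  refine ⟨j ∘ Ψ, hj.comp hinj, ?_, isLocalIsometry_comp (by simp) hΨ hiso⟩
  rw [Set.range_comp, hrange]

/-- **`TameHull.IsKerrDoc` pushes forward along an orientation-preserving injective local isometry.** If
`O' ⊆ 𝓢'` is EXACTLY a Kerr exterior `(M, a)` and `j : 𝓢' → 𝓢` is an injective local isometry whose differential
maps future-directed vectors to future-directed vectors, then `j '' O'` is exactly a Kerr exterior `(M, a)` of
`𝓢`: the chart `j ∘ Ψ'` is injective, `C^∞`, has image `j '' O'`, the same — vanishing — Kerr–Schild deviation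
(`DarkFuture.deviation_comp_of_isLocalIsometry`), and `(j ∘ Ψ')_* ∂_{t*} = dj (Ψ'_* ∂_{t*})` is future-directed
on `{r > 2M}`. O'Neill 1983, Ch. 3, pp. 90–91 and Ch. 5, p. 145; Dafermos–Luk 2017, Conjecture 1.
[cite: ONeill1983, Ch. 3, pp. 90–91] -/
theorem isKerrDoc_image_of_isLocalIsometry : ∀ {𝓢 𝓢' : Spacetime.{0} 4} (j : 𝓢'.carrier → 𝓢.carrier) (O' : Set 𝓢'.carrier) (M a : ℝ), Function.Injective j → PseudoRiemannianMetric.IsLocalIsometry 𝓢'.metric.toPseudoRiemannianMetric 𝓢.metric.toPseudoRiemannianMetric j → (∀ (x : 𝓢'.carrier) (v : TangentSpace (𝓡 4) x), 𝓢'.timeOrientation.IsFutureDirected v → 𝓢.timeOrientation.IsFutureDirected (mfderiv (𝓡 4) (𝓡 4) j x v)) → IsKerrDoc 𝓢' O' M a → IsKerrDoc 𝓢 (j '' O') M a := by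
  intro 𝓢 𝓢' j O' M a hj hiso hfut hdoc
  obtain ⟨Ψ', hinj, hsmooth, hrange, hdev, hfut'⟩ := hdoc
  have hjsm : ContMDiff (𝓡 4) (𝓡 4) ∞ j := hiso.1.contMDiff
  have hmd : MDifferentiable 𝓘(ℝ, E4) (𝓡 4) Ψ' := hsmooth.mdifferentiable (by simp)
  refine ⟨j ∘ Ψ', hj.comp hinj, hjsm.comp hsmooth, ?_, fun x ↦ ?_, fun x hx ↦ ?_⟩
  · rw [Set.range_comp, hrange]
  · exact (deviation_comp_of_isLocalIsometry (Kerr.background M a) hiso hmd x).trans (hdev x)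
  · rw [mfderiv_comp x (hiso.1.mdifferentiable (by simp) (Ψ' x)) (hmd x)]
    exact hfut _ _ (hfut' x hx)

/-- **`TameHull.IsMinkowski` pushes forward along an orientation-preserving BIJECTIVE local isometry** (a global
isometry presented as a map): compose the exact flat chart with `j`; bijectivity, smoothness, vanishing deviation
from `η` (`(j ∘ Ψ)^* g = Ψ^* (j^* g) = Ψ^* g'`) and future-directedness of `∂₀` are preserved. O'Neill 1983,
Ch. 3, p. 58 and Ch. 5, p. 145. [cite: ONeill1983, Ch. 3, Def. 3.4 (p. 58)] -/
theorem isMinkowski_of_isLocalIsometry_of_surjective {𝓢 𝓢' : Spacetime.{0} 4} {j : 𝓢'.carrier → 𝓢.carrier}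
    (hj : Function.Injective j) (hsurj : Function.Surjective j)
    (hiso : PseudoRiemannianMetric.IsLocalIsometry 𝓢'.metric.toPseudoRiemannianMetric
      𝓢.metric.toPseudoRiemannianMetric j)
    (hfut : ∀ (x : 𝓢'.carrier) (v : TangentSpace (𝓡 4) x), 𝓢'.timeOrientation.IsFutureDirected v →
      𝓢.timeOrientation.IsFutureDirected (mfderiv (𝓡 4) (𝓡 4) j x v))
    (h : IsMinkowski 𝓢') : IsMinkowski 𝓢 := by
  obtain ⟨Ψ, hbij, hsmooth, hdev, hfutΨ⟩ := h
  have hjsm : ContMDiff (𝓡 4) (𝓡 4) ∞ j := hiso.1.contMDiff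
  have hmd : MDifferentiable 𝓘(ℝ, E4) (𝓡 4) Ψ := hsmooth.mdifferentiable (by simp)
  have hjmd : MDifferentiable (𝓡 4) (𝓡 4) j := hiso.1.mdifferentiable (by simp)
  refine ⟨j ∘ Ψ, (show Function.Bijective j from ⟨hj, hsurj⟩).comp hbij, hjsm.comp hsmooth,
    fun x ↦ ?_, fun x ↦ ?_⟩
  · -- `(j ∘ Ψ)^* g − η = Ψ^* g' − η = 0`
    have hpb : pullbackBilin (I := 𝓡 4) (I' := 𝓘(ℝ, E4)) (j ∘ Ψ) 𝓢.metric.val =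
        pullbackBilin (I := 𝓡 4) (I' := 𝓘(ℝ, E4)) Ψ 𝓢'.metric.val := by
      rw [pullbackBilin_comp hjmd hmd]
      exact congrArg (pullbackBilin (I := 𝓡 4) (I' := 𝓘(ℝ, E4)) Ψ) (funext hiso.2)
    have h0 := hdev x
    rw [Spacetime.minkowskiDeviation] at h0 ⊢
    rw [show (pullbackBilin (I := 𝓡 4) (I' := 𝓘(ℝ, E4)) (j ∘ Ψ) 𝓢.metric.val x : E4 →L[ℝ] E4 →L[ℝ] ℝ) =
        pullbackBilin (I := 𝓡 4) (I' := 𝓘(ℝ, E4)) Ψ 𝓢'.metric.val x from congrFun hpb x]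
    exact h0
  · rw [mfderiv_comp x (hjmd (Ψ x)) (hmd x)]
    exact hfut _ _ (hfutΨ x)

end Summit.FinalStateConjecture.FinalStateConjecture.Theorems.TameLaSalle

end
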